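import Literature.Topology.FourManifolds.FishtailReparam
import Literature.Topology.FourManifolds.FishtailDiscPolar
import Literature.Topology.FourManifolds.IwaseToriLoop
import HarnessLib

/-!
# Elementary real estimates for the fishtail parameters

Infrastructure for the explicit fishtail neighbourhood (R. Gompf, *More Cappell–Shaneson spheres
are standard*, Algebr. Geom. Topol. 10 (2010), proof of Thm 2.1 and Lemma 2.2; the named fact
`Literature.Topology.FourManifolds.gompf2010_framedTwist`). Calculus facts used to verify the
plateau and window conditions of the concrete parameters: bounds for `arctan`
(`x/(1+x²) ≤ arctan x`, `arctan y - arctan x ≤ y - x`; `arctan x ≤ x` is `IwaseTori.arctan_le_self`), the master angles at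
radii with closed-form tangents (`angleUp r₀ (r₀ + tan θ) = π/4 + 3θ/2`), the foot height at
`π - y` (`footY ρ (π - y) = ρ + ρ / tan y`) with monotone comparison, a Lipschitz estimate for
`tan`, the bound `r/√(1+r²) < c`, and antitonicity of `capRad`.

Everything is proved; no named facts.

## References

* R. E. Gompf, *More Cappell–Shaneson spheres are standard*, Algebr. Geom. Topol. 10 (2010)
  1665–1681, proof of Thm 2.1 and Lemma 2.2. [GompfAGT2010]
-/

noncomputable section

open scoped Real Topology
open Set Real

namespace Literature.Topology.FourManifolds

/-! ### `arctan` bounds -/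

/-- `x / (1 + x²) ≤ arctan x` for `x ≥ 0` (`= sin y cos y ≤ sin y ≤ y` for `y = arctan x`; an
elementary proof — the same inequality is proved by integration in the Bose-gas barrier file
`EnergyAsymptoticsWithoutCondensationProofs`, which we do not import into this construction). [folklore] -/
theorem div_one_add_sq_le_arctan {x : ℝ} (hx : 0 ≤ x) : x / (1 + x ^ 2) ≤ arctan x := by
  set y := arctan x with hy
  have hy0 : 0 ≤ y := arctan_nonneg.2 hx
  have hy2 : y < π / 2 := arctan_lt_pi_div_two x
  have hcos : 0 < cos y := cos_pos_of_mem_Ioo ⟨by linarith [pi_pos], hy2⟩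
  have hx' : x = tan y := (tan_arctan x).symm
  have hsin0 : 0 ≤ sin y := sin_nonneg_of_nonneg_of_le_pi hy0 (by linarith [pi_pos])
  have h1 : x / (1 + x ^ 2) = sin y * cos y := by
    rw [hx', tan_eq_sin_div_cos]
    have hc2 : sin y ^ 2 + cos y ^ 2 = 1 := sin_sq_add_cos_sq y
    field_simp
    nlinarith [hc2]
  rw [h1]
  calc sin y * cos y ≤ sin y * 1 := mul_le_mul_of_nonneg_left (cos_le_one y) hsin0
    _ = sin y := mul_one _
    _ ≤ y := sin_le hy0

/-- `arctan y - arctan x ≤ y - x` for `0 ≤ x ≤ y`. [folklore] -/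
theorem arctan_sub_arctan_le {x y : ℝ} (hx : 0 ≤ x) (hxy : x ≤ y) : arctan y - arctan x ≤ y - x := by
  have hprod : y * -x < 1 := by nlinarith
  have h := arctan_add hprod
  rw [arctan_neg, ← sub_eq_add_neg] at h
  rw [h]
  have hden : 1 ≤ 1 - y * -x := by nlinarith
  have hnum : 0 ≤ y + -x := by linarith
  calc arctan ((y + -x) / (1 - y * -x)) ≤ (y + -x) / (1 - y * -x) := IwaseTori.arctan_le_self (div_nonneg hnum (by linarith))
    _ ≤ (y + -x) / 1 := div_le_div_of_nonneg_left hnum one_pos hden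
    _ = y - x := by ring

/-- `|arctan y - arctan x| ≤ |y - x|`. [folklore] -/
theorem abs_arctan_sub_arctan_le (x y : ℝ) : |arctan y - arctan x| ≤ |y - x| := by
  -- via the mean value inequality with `|arctan'| ≤ 1`
  have hd : ∀ t, HasDerivAt arctan (1 / (1 + t ^ 2)) t := fun t ↦ Real.hasDerivAt_arctan t
  have hb : ∀ t ∈ (univ : Set ℝ), ‖(1 : ℝ) / (1 + t ^ 2)‖ ≤ 1 := fun t _ ↦ by
    rw [Real.norm_eq_abs, abs_of_pos (by positivity)]
    exact div_le_one_of_le₀ (by nlinarith) (by positivity)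
  have h := convex_univ.norm_image_sub_le_of_norm_hasDerivWithin_le (fun t _ ↦ (hd t).hasDerivWithinAt) hb
    (mem_univ x) (mem_univ y)
  simpa using h

/-! ### The master angles at radii with closed-form tangents -/

/-- `α(r₀ + tan θ) = π/4 + 3θ/2` for `|θ| < π/2`. [folklore] -/
theorem angleUp_add_tan (r₀ : ℝ) {θ : ℝ} (h1 : -(π / 2) < θ) (h2 : θ < π / 2) :
    angleUp r₀ (r₀ + tan θ) = π / 4 + 3 / 2 * θ := by
  rw [angleUp, add_sub_cancel_left, arctan_tan h1 h2]

/-- `β(r₁ - tan θ) = π/4 + 3θ/2` for `|θ| < π/2`. [folklore] -/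
theorem angleDown_sub_tan (r₁ : ℝ) {θ : ℝ} (h1 : -(π / 2) < θ) (h2 : θ < π / 2) :
    angleDown r₁ (r₁ - tan θ) = π / 4 + 3 / 2 * θ := by
  rw [angleDown, show r₁ - tan θ - r₁ = -tan θ by ring, arctan_neg, arctan_tan h1 h2]; ring

/-- `β(r₁ + tan θ) = π/4 - 3θ/2` for `|θ| < π/2`. [folklore] -/
theorem angleDown_add_tan (r₁ : ℝ) {θ : ℝ} (h1 : -(π / 2) < θ) (h2 : θ < π / 2) :
    angleDown r₁ (r₁ + tan θ) = π / 4 - 3 / 2 * θ := by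
  rw [angleDown, add_sub_cancel_left, arctan_tan h1 h2]

/-- `α(r₀ - √3) = -π/4`, `α(r₀ - 1/√3) = 0`, `α(r₀ + 1/√3) = π/2`, `α(r₀ + √3) = 3π/4`. [folklore] -/
theorem angleUp_sub_sqrt_three (r₀ : ℝ) : angleUp r₀ (r₀ - Real.sqrt 3) = -(π / 4) := by
  have h := angleUp_add_tan r₀ (θ := -(π / 3)) (by linarith [pi_pos]) (by linarith [pi_pos])
  rw [tan_neg, tan_pi_div_three, ← sub_eq_add_neg] at h
  rw [h]; ring

/-- `α(r₀ - 1/√3) = 0`. [folklore] -/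
theorem angleUp_sub_inv_sqrt_three (r₀ : ℝ) : angleUp r₀ (r₀ - 1 / Real.sqrt 3) = 0 := by
  have h := angleUp_add_tan r₀ (θ := -(π / 6)) (by linarith [pi_pos]) (by linarith [pi_pos])
  rw [tan_neg, tan_pi_div_six, ← sub_eq_add_neg] at h
  rw [h]; ring

/-- `α(r₀ + 1/√3) = π/2`. [folklore] -/
theorem angleUp_add_inv_sqrt_three (r₀ : ℝ) : angleUp r₀ (r₀ + 1 / Real.sqrt 3) = π / 2 := by
  have h := angleUp_add_tan r₀ (θ := π / 6) (by linarith [pi_pos]) (by linarith [pi_pos])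
  rw [tan_pi_div_six] at h
  rw [h]; ring

/-- `α(r₀ + √3) = 3π/4`. [folklore] -/
theorem angleUp_add_sqrt_three (r₀ : ℝ) : angleUp r₀ (r₀ + Real.sqrt 3) = 3 * π / 4 := by
  have h := angleUp_add_tan r₀ (θ := π / 3) (by linarith [pi_pos]) (by linarith [pi_pos])
  rw [tan_pi_div_three] at h
  rw [h]; ring

/-- `β(r₁ - √3) = 3π/4`, `β(r₁ + 1/√3) = 0`, `β(r₁ + √3) = -π/4`. [folklore] -/
theorem angleDown_sub_sqrt_three (r₁ : ℝ) : angleDown r₁ (r₁ - Real.sqrt 3) = 3 * π / 4 := by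
  have h := angleDown_sub_tan r₁ (θ := π / 3) (by linarith [pi_pos]) (by linarith [pi_pos])
  rw [tan_pi_div_three] at h
  rw [h]; ring

/-- `β(r₁ + 1/√3) = 0`. [folklore] -/
theorem angleDown_add_inv_sqrt_three (r₁ : ℝ) : angleDown r₁ (r₁ + 1 / Real.sqrt 3) = 0 := by
  have h := angleDown_add_tan r₁ (θ := π / 6) (by linarith [pi_pos]) (by linarith [pi_pos])
  rw [tan_pi_div_six] at h
  rw [h]; ring

/-- `β(r₁ + √3) = -π/4`. [folklore] -/
theorem angleDown_add_sqrt_three (r₁ : ℝ) : angleDown r₁ (r₁ + Real.sqrt 3) = -(π / 4) := by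
  have h := angleDown_add_tan r₁ (θ := π / 3) (by linarith [pi_pos]) (by linarith [pi_pos])
  rw [tan_pi_div_three] at h
  rw [h]; ring

/-- **For `x > 0`: `α(r₀ + x) = π - (3/2) arctan (1/x)`.** [folklore] -/
theorem angleUp_eq_pi_sub (r₀ : ℝ) {x : ℝ} (hx : 0 < x) : angleUp r₀ (r₀ + x) = π - 3 / 2 * arctan x⁻¹ := by
  rw [angleUp, add_sub_cancel_left, arctan_inv_of_pos hx]; ring

/-- For `x > 0`: `α(r₀ - x) = -(π/2) + (3/2) arctan (1/x)`. [folklore] -/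
theorem angleUp_eq_neg_add (r₀ : ℝ) {x : ℝ} (hx : 0 < x) : angleUp r₀ (r₀ - x) = -(π / 2) + 3 / 2 * arctan x⁻¹ := by
  rw [angleUp, show r₀ - x - r₀ = -x by ring, arctan_neg, arctan_inv_of_pos hx]; ring

/-- For `x > 0`: `β(r₁ - x) = π - (3/2) arctan (1/x)`. [folklore] -/
theorem angleDown_eq_pi_sub (r₁ : ℝ) {x : ℝ} (hx : 0 < x) : angleDown r₁ (r₁ - x) = π - 3 / 2 * arctan x⁻¹ := by
  rw [angleDown, show r₁ - x - r₁ = -x by ring, arctan_neg, arctan_inv_of_pos hx]; ring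

/-- The master angles are `3/2`-Lipschitz. [folklore] -/
theorem abs_angleUp_sub_le (r₀ r r' : ℝ) : |angleUp r₀ r - angleUp r₀ r'| ≤ 3 / 2 * |r - r'| := by
  rw [angleUp, angleUp, show π / 4 + 3 / 2 * arctan (r - r₀) - (π / 4 + 3 / 2 * arctan (r' - r₀)) =
    3 / 2 * (arctan (r - r₀) - arctan (r' - r₀)) by ring, abs_mul, abs_of_pos (by norm_num : (0:ℝ) < 3 / 2)]
  refine mul_le_mul_of_nonneg_left ?_ (by norm_num)
  have h := abs_arctan_sub_arctan_le (r' - r₀) (r - r₀)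
  rwa [show r - r₀ - (r' - r₀) = r - r' by ring] at h

/-- The descending master angle is `3/2`-Lipschitz. [folklore] -/
theorem abs_angleDown_sub_le (r₁ r r' : ℝ) : |angleDown r₁ r - angleDown r₁ r'| ≤ 3 / 2 * |r - r'| := by
  rw [angleDown, angleDown, show π / 4 - 3 / 2 * arctan (r - r₁) - (π / 4 - 3 / 2 * arctan (r' - r₁)) =
    -(3 / 2 * (arctan (r - r₁) - arctan (r' - r₁))) by ring, abs_neg, abs_mul,
    abs_of_pos (by norm_num : (0:ℝ) < 3 / 2)]
  refine mul_le_mul_of_nonneg_left ?_ (by norm_num)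
  have h := abs_arctan_sub_arctan_le (r' - r₁) (r - r₁)
  rwa [show r - r₁ - (r' - r₁) = r - r' by ring] at h

/-! ### `tan` estimates -/

/-- `tan a - tan b = sin (a - b) / (cos a cos b)`. [folklore] -/
theorem tan_sub_tan {a b : ℝ} (ha : cos a ≠ 0) (hb : cos b ≠ 0) :
    tan a - tan b = sin (a - b) / (cos a * cos b) := by
  rw [tan_eq_sin_div_cos, tan_eq_sin_div_cos, sin_sub]
  field_simp

/-- **Lipschitz estimate for `tan`**: `|tan a - tan b| ≤ |a - b| / (cos a cos b)` when both
cosines are positive. [folklore] -/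
theorem abs_tan_sub_tan_le {a b : ℝ} (ha : 0 < cos a) (hb : 0 < cos b) :
    |tan a - tan b| ≤ |a - b| / (cos a * cos b) := by
  rw [tan_sub_tan ha.ne' hb.ne', abs_div, abs_of_pos (mul_pos ha hb)]
  exact div_le_div_of_nonneg_right (abs_sin_le_abs) (mul_pos ha hb).le

/-- `1 - x²/2 ≤ cos x`, so `cos x ≥ 199/200` for `|x| ≤ 1/10`. [folklore] -/
theorem cos_ge_of_abs_le {x : ℝ} (hx : |x| ≤ 1 / 10) : 199 / 200 ≤ cos x := by
  have h := Real.one_sub_sq_div_two_le_cos (x := x)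
  have hx2 : x ^ 2 ≤ 1 / 100 := by
    have := abs_nonneg x
    calc x ^ 2 = |x| ^ 2 := (sq_abs x).symm
      _ ≤ (1 / 10) ^ 2 := pow_le_pow_left₀ this hx 2
      _ = 1 / 100 := by norm_num
  linarith

/-- For `0 < y < π/2`: `tan (y - π/2) = -(tan y)⁻¹ ≥ -y⁻¹`. [folklore] -/
theorem tan_sub_pi_div_two {y : ℝ} : tan (y - π / 2) = -(tan y)⁻¹ := by
  rw [show y - π / 2 = -(π / 2 - y) by ring, tan_neg, tan_pi_div_two_sub]

/-- `-1/y ≤ tan (y - π/2)` for `0 < y < π/2`. [folklore] -/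
theorem neg_inv_le_tan_sub_pi_div_two {y : ℝ} (hy0 : 0 < y) (hy : y < π / 2) : -y⁻¹ ≤ tan (y - π / 2) := by
  rw [tan_sub_pi_div_two, neg_le_neg_iff]
  exact inv_anti₀ hy0 (Real.le_tan hy0.le hy)

/-! ### The foot height -/

/-- **`footY ρ (π - y) = ρ + ρ / tan y`.** [folklore] -/
theorem footY_pi_sub (ρ y : ℝ) : footY ρ (π - y) = ρ + ρ / tan y := by
  rw [footY, cos_pi_sub, sin_pi_sub, tan_eq_sin_div_cos]
  rw [neg_div, mul_neg, sub_neg_eq_add, div_div_eq_mul_div, mul_div_assoc]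

/-- `footY ρ (3π/4) = 2ρ`. [folklore] -/
theorem footY_three_pi_div_four (ρ : ℝ) : footY ρ (3 * π / 4) = 2 * ρ := by
  rw [show 3 * π / 4 = π - π / 4 by ring, footY_pi_sub, tan_pi_div_four]; ring

/-- `footY ρ (π - arctan (1/3)) = 4ρ`. [folklore] -/
theorem footY_pi_sub_arctan_third (ρ : ℝ) : footY ρ (π - arctan (1 / 3)) = 4 * ρ := by
  rw [footY_pi_sub, tan_arctan]; ring

/-- Monotone comparison of foot heights: for `0 < ψ ≤ ψ' < π`, `footY ρ ψ ≤ footY ρ ψ'` (`ρ > 0`). [folklore] -/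
theorem footY_le_footY {ρ : ℝ} (hρ : 0 < ρ) {ψ ψ' : ℝ} (h0 : 0 < ψ) (hle : ψ ≤ ψ') (hπ : ψ' < π) :
    footY ρ ψ ≤ footY ρ ψ' :=
  (strictMonoOn_footY hρ).monotoneOn ⟨h0, by linarith⟩ ⟨by linarith, hπ⟩ hle

/-- **Upper bound of the foot height below `π - y`**: `footY ρ ψ ≤ ρ + ρ / y'` whenever
`0 < ψ ≤ π - y`, `0 < y' ≤ y < π/2` (using `tan y ≥ y ≥ y'`). [folklore] -/
theorem footY_le_of_le_pi_sub {ρ : ℝ} (hρ : 0 < ρ) {ψ y y' : ℝ} (h0 : 0 < ψ) (hψ : ψ ≤ π - y) (hy'0 : 0 < y')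
    (hy' : y' ≤ y) (hy : y < π / 2) : footY ρ ψ ≤ ρ + ρ / y' := by
  have hy0 : 0 < y := by linarith
  have h1 : footY ρ ψ ≤ footY ρ (π - y) := footY_le_footY hρ h0 hψ (by linarith)
  rw [footY_pi_sub] at h1
  have ht : y' ≤ tan y := hy'.trans (Real.le_tan hy0.le hy)
  have h2 : ρ / tan y ≤ ρ / y' := div_le_div_of_nonneg_left hρ.le hy'0 ht
  linarith

/-- **Lower bound of the foot height above `π - y`**: `ρ + ρ / tan y ≤ footY ρ ψ` whenever
`π - y ≤ ψ < π`, `0 < y < π/2`. [folklore] -/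
theorem le_footY_of_pi_sub_le {ρ : ℝ} (hρ : 0 < ρ) {ψ y : ℝ} (hy0 : 0 < y) (hy : y < π / 2) (hψ : π - y ≤ ψ)
    (hπ : ψ < π) : ρ + ρ / tan y ≤ footY ρ ψ := by
  have h1 : footY ρ (π - y) ≤ footY ρ ψ := footY_le_footY hρ (by linarith) hψ hπ
  rwa [footY_pi_sub] at h1

/-! ### `r / √(1 + r²)` -/

/-- `r / √(1 + r²) < c` as soon as `r² < c² (1 + r²)`, `0 < c`. [folklore] -/
theorem div_sqrt_one_add_sq_lt {r c : ℝ} (hc : 0 < c) (h : r ^ 2 < c ^ 2 * (1 + r ^ 2)) :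
    r / Real.sqrt (1 + r ^ 2) < c := by
  have hs : 0 < Real.sqrt (1 + r ^ 2) := Real.sqrt_pos.2 (by positivity)
  rw [div_lt_iff₀ hs]
  rcases le_or_gt r 0 with hr | hr
  · exact lt_of_le_of_lt hr (mul_pos hc hs)
  · have h2 : r ^ 2 < (c * Real.sqrt (1 + r ^ 2)) ^ 2 := by
      rw [mul_pow, Real.sq_sqrt (by positivity)]; exact h
    have h3 := Real.sqrt_lt_sqrt (sq_nonneg r) h2
    rwa [Real.sqrt_sq hr.le, Real.sqrt_sq (by positivity)] at h3

/-- `r / √(1 + r²) ≤ 1`. [folklore] -/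
theorem div_sqrt_one_add_sq_le_one (r : ℝ) : r / Real.sqrt (1 + r ^ 2) ≤ 1 := by
  have hs : 0 < Real.sqrt (1 + r ^ 2) := Real.sqrt_pos.2 (by positivity)
  rw [div_le_one hs]
  calc r ≤ |r| := le_abs_self r
    _ = Real.sqrt (r ^ 2) := (Real.sqrt_sq_eq_abs r).symm
    _ ≤ Real.sqrt (1 + r ^ 2) := Real.sqrt_le_sqrt (by linarith)

/-- `southLat ε r = ε r / √(1 + r²)`. [folklore] -/
theorem southLat_eq (ε r : ℝ) : southLat ε r = ε * (r / Real.sqrt (1 + r ^ 2)) := by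
  rw [southLat, capLat]; ring

/-! ### `capRad` is antitone on `(-ε, 0]` -/

/-- `capRad ε` is antitone on `(-ε, 0]`. [folklore] -/
theorem capRad_le_capRad {ε n n' : ℝ} (hn : -ε < n) (hnn' : n ≤ n') (hn' : n' ≤ 0) : capRad ε n' ≤ capRad ε n := by
  have hε : 0 < ε := by linarith
  have h1 : 0 < ε ^ 2 - n ^ 2 := by nlinarith
  have h1' : 0 < ε ^ 2 - n' ^ 2 := by nlinarith
  have hs : 0 < Real.sqrt (ε ^ 2 - n ^ 2) := Real.sqrt_pos.2 h1
  have hs' : 0 < Real.sqrt (ε ^ 2 - n' ^ 2) := Real.sqrt_pos.2 h1'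
  have hss : Real.sqrt (ε ^ 2 - n ^ 2) ≤ Real.sqrt (ε ^ 2 - n' ^ 2) := Real.sqrt_le_sqrt (by nlinarith)
  rw [capRad, capRad, div_le_div_iff₀ hs' hs]
  nlinarith [mul_le_mul_of_nonneg_left hss (by linarith : (0:ℝ) ≤ -n')]

end Literature.Topology.FourManifolds
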